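import Summits.AtomisticToContinuum.HydrodynamicLimit.Theorems.TwoClocksEquilibriumFastWindowLDReductionBounded
import Summits.AtomisticToContinuum.HydrodynamicLimit.Theorems.TwoClocksEquilibriumFastWindowLDStubTiltDuality
import Summits.AtomisticToContinuum.HydrodynamicLimit.Theses.TwoClocks

/-!
# `EquilibriumFastWindowLD` from its perturbative entropy normal form
(crux stmt-AtomisticToContinuum-14440, line `Sketch`, skeleton rev 5.1; lead c3)

The composition of the line `Sketch` as a closed implication: the crux
`TwoClocks.EquilibriumFastWindowLD` follows from the ENTROPY-LINEAR RELAXATION BOUND `P`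
(= the registered open stub `stub_perturbativeRelaxation`): for every `C' ≥ 0` there are a rate
`β₁ > 0` and an entropy radius `s₀ > 0`, uniform over the bounded class `𝒢(C')` (continuous `G`,
`|G(x,v)| ≤ C'(1+|v|²)`, compact `v`-support, `M_{1,u₀,θ₀}`-orthogonal at every `x` to
`1, v_j, |v|²`), such that for every `G ∈ 𝒢(C')` and `ε > 0` there is a window `τ` with, eventually
in `N`, for every probability law `Q ≪ G_N` with `H(Q | G_N) ≤ s₀ (N+1)`:
`β₁ · E_Q[Σᵢ w⁻¹∫₀ʷ G((Φ_N.flow r z)ᵢ) dr] ≤ H(Q | G_N) + ε (N+1)`, `w = τ (N+1)^{-1/3}`.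

`EquilibriumFastWindowLD_of_perturbativeRelaxation : P → EquilibriumFastWindowLD` is
`EquilibriumFastWindowLD_of_boundedWindowLD ∘ stub_tiltDuality` (p125773 ∘ p127451): Gibbs–entropy
duality (`P → W`, the bounded-class window LD with class-uniform tilt range) followed by the static
normal-form step (`W →` crux: tails by Hölder against the static MGF, truncation with dual-family
recentring). With `perturbativeRelaxation_of_boundedWindowLD : W → P` (p127561) the three currencies
`P`, `W` are equivalent and each implies the crux; `P` is the form in which a dynamical proof (relative
entropy of perturbations of the global Gibbs state of the hard-sphere fluid at fixed small volume
fraction, relaxed over `τσ²√θ₀` mean free times) would be written. Nothing static remains between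
`P` and the crux.
-/

noncomputable section

open MeasureTheory ProbabilityTheory Real Set Filter InformationTheory
open scoped ENNReal BigOperators

namespace Summit.AtomisticToContinuum.HydrodynamicLimit.Theorems.FastWindowRG

open Literature.Analysis.FluidPDE Literature.MathematicalPhysics.KineticTheory

/-- **The crux from its perturbative entropy normal form** (`P → EquilibriumFastWindowLD`;
composition of the line `Sketch`, skeleton rev 5.1, with the open stub as hypothesis):
`EquilibriumFastWindowLD_of_boundedWindowLD (stub_tiltDuality hP)`. -/
theorem EquilibriumFastWindowLD_of_perturbativeRelaxation :
    (∃ σ₀ : ℝ, 0 < σ₀ ∧ ∀ (a₀ θ₀ : ℝ) (u₀ : V3), 0 < a₀ → 0 < θ₀ → ∀ σ : ℝ, 0 < σ → σ < σ₀ →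
      ∀ Φ : (N : ℕ) → HardSphereFlow (Torus.geometry (Fin 3)) (hsDiameter σ N) (N + 1),
      ∀ C' : ℝ, 0 ≤ C' → ∃ β₁ : ℝ, 0 < β₁ ∧ ∃ s₀ : ℝ, 0 < s₀ ∧
      ∀ G : T3 × V3 → ℝ, Continuous G → (∀ y, |G y| ≤ C' * (1 + ‖y.2‖ ^ 2)) →
      (∃ R : ℝ, ∀ y : T3 × V3, R ≤ ‖y.2‖ → G y = 0) →
      (∀ x, ∫ v, G (x, v) * localMaxwellian 1 θ₀ u₀ v = 0) →
      (∀ x (j : Fin 3), ∫ v, G (x, v) * v j * localMaxwellian 1 θ₀ u₀ v = 0) →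
      (∀ x, ∫ v, G (x, v) * ‖v‖ ^ 2 * localMaxwellian 1 θ₀ u₀ v = 0) →
      ∀ ε : ℝ, 0 < ε → ∃ τ : ℝ, 0 < τ ∧ ∃ N₀ : ℕ, ∀ N : ℕ, N₀ ≤ N →
        ∀ Q : Measure (Config (N + 1) (Fin 3) T3), IsProbabilityMeasure Q →
          Q ≪ localGibbsLaw σ (fun _ => a₀) (fun _ => u₀) (fun _ => θ₀) N (Φ N) →
          klDiv Q (localGibbsLaw σ (fun _ => a₀) (fun _ => u₀) (fun _ => θ₀) N (Φ N)) ≤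
            ENNReal.ofReal (s₀ * ((N : ℝ) + 1)) →
          β₁ * ∫ z, (∑ i : Fin (N + 1), (τ * ((N : ℝ) + 1) ^ (-(1 / 3 : ℝ)))⁻¹ *
              ∫ r in (0 : ℝ)..(τ * ((N : ℝ) + 1) ^ (-(1 / 3 : ℝ))), G (((Φ N).flow r z) i)) ∂Q ≤
            (klDiv Q (localGibbsLaw σ (fun _ => a₀) (fun _ => u₀) (fun _ => θ₀) N (Φ N))).toReal +
              ε * ((N : ℝ) + 1)) →
    Summit.AtomisticToContinuum.HydrodynamicLimit.Theses.TwoClocks.EquilibriumFastWindowLD :=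
  fun hP => EquilibriumFastWindowLD_of_boundedWindowLD (stub_tiltDuality hP)

end Summit.AtomisticToContinuum.HydrodynamicLimit.Theorems.FastWindowRG

end
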